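import Summits.QuantumFields.YangMills.Theorems.DiagonalMirrorRPRCubeHalfRPAction

/-!
# Crux `WeakCouplingHypercubicLimitRP` (stmt-QuantumFields-27398), line `Sketch`, stub D1′ `stub_oddTorusSwapPairingLiminf`, door C
# (`cube-surgery-decoupling`, card #114), S1a part 3/4: the CUT `(0,1)`-plaquettes on the mirror as a Gram kernel; the observable `g`

Helper file (`--supports stmt-QuantumFields-27398 --as helper`) of the crux lead `lead-27398-D1` (gen 2); part 3 of the proof of S1a
`cubeHalfRP : CubeHalfRP G` (continues `…DiagonalMirrorRPRCubeHalfRPAction`).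

WHAT.  For a cut plaquette (plane `(0,1)`, base on the mirror `v = 0`) the holonomy factors as `U_p = W₊ · (W₊ ∘ Θ)⁻¹` with
`W₊ = U(x,e₀) U(x+e₀,e₁)` in the closed positive half-cube, so `Re tr ρ(U_p) = Re ∑_{ab} ρ(W₊(U))_{ab} conj ρ(W₊(Θ U))_{ab}`
(`re_trace_eq_of_mem_cut`, unitarity), and with the Gram coefficients `aᵢ ∈ {√(β/2) ρ(W₊)_{ab}, √(β/2) conj ρ(W₊)_{ab}}` on cut plaquettes
(`0` elsewhere) **`sum_a_mul_conj`**: `∑ᵢ aᵢ(U) conj aᵢ(Θ U) = β X_cut(U)` for `β ≥ 0`; the `aᵢ` are bounded by `√(β/2)`, measurable, and depend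
only on closed-positive links.  The observable `g = F · e^{β X_pos + β X_sh/2}` is bounded, measurable and depends only on closed-positive links;
`Θ` preserves product Haar measure (`measurePreserving_configPerm_swap`, a relabelling of the factors).  Pattern: `Literature/…/TiltedTorusSwapRP`
§§Cut/Observable (two mirror layers there, one here).

HONEST FRAMING: bookkeeping for an exact finite-volume identity (S1a `cubeHalfRP`, file `…DiagonalMirrorRPRCubeHalfRP`); nothing asymptotic,
no letter of door B or C is proved; D1′, ⟨27398⟩ and its heart S6i are OPEN; nothing here bears on the summit; the Yang–Mills mass gap is NOT
proved here or anywhere in the tree.  Definition-free (bookkeeping objects are parameters constrained by defining equations, sub-namespace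
`HalfRP`); no instance, no notation, `autoImplicit false`.

References: J. Fröhlich, R. Israel, E. H. Lieb, B. Simon, Comm. Math. Phys. 62 (1978) 1, Thm 2.1; K. Osterwalder, E. Seiler, Ann. Phys. 110
(1978) 440, §2; E. Seiler, LNP 159 (1982) Ch. 2.
-/

set_option autoImplicit false

noncomputable section

open scoped SchwartzMap ComplexConjugate ComplexOrder
open MeasureTheory Filter Topology Finset Complex
open Literature.MathematicalPhysics.QuantumLattice Literature.MathematicalPhysics.AQFT
  Literature.MathematicalPhysics.QuantumFieldTheory
open Literature.Probability.LatticeModels (box)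
open Summit.QuantumFields.YangMills.Cruxes.DiagonalMirrorRPR.ParityBridgeColdTraces (E4)

namespace Summit.QuantumFields.YangMills.Cruxes.DiagonalMirrorRPR.CubeSurgery

namespace HalfRP

/-! ## §3 (continued) Bookkeeping objects as constrained parameters -/

section Param

variable {G : Type} [Group G] [MeasurableSpace G] {S : ℕ} [NeZero S] {R : ℕ} (hRS : 2 * R + 1 ≤ S)
  {d : {q : Fin 4 × Fin 4 // q.1 < q.2} → {q : Fin 4 × Fin 4 // q.1 < q.2}}
  {τ : Plaquette 4 S → Plaquette 4 S}
  {M P : Finset (Edge 4 S)} {cube cut sh pos neg : Finset (Plaquette 4 S)}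

variable
  (hd : ∀ q, (d q).1 = if q.1 = ((0 : Fin 4), (1 : Fin 4)) then q.1
    else (Equiv.swap (0 : Fin 4) 1 q.1.1, Equiv.swap (0 : Fin 4) 1 q.1.2))
  (hτ : ∀ p, τ p = (sitePerm (Equiv.swap (0 : Fin 4) 1) p.1, d p.2))
  (hM : ∀ e, e ∈ M ↔ PosHalfEdge S R e ∧ (e.2 = 2 ∨ e.2 = 3) ∧ rep S e.1 0 = rep S e.1 1)
  (hP : ∀ e, e ∈ P ↔ PosHalfEdge S R e ∧ e ∉ M)
  (hcube : ∀ p, p ∈ cube ↔ PlaqInCube S R p)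
  (hcut : ∀ p, p ∈ cut ↔ PlaqInCube S R p ∧ p.2.1 = (0, 1) ∧ rep S p.1 0 = rep S p.1 1)
  (hsh : ∀ p, p ∈ sh ↔ PlaqInCube S R p ∧ p.2.1 = (2, 3) ∧ rep S p.1 0 = rep S p.1 1)
  (hpos : ∀ p, p ∈ pos ↔ PlaqInCube S R p ∧
    ((p.2.1.1 = 0 ∧ p.2.1.2 = 1 ∧ 1 ≤ rep S p.1 0 - rep S p.1 1) ∨
      (p.2.1.1 = 0 ∧ (p.2.1.2 = 2 ∨ p.2.1.2 = 3) ∧ 0 ≤ rep S p.1 0 - rep S p.1 1) ∨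
      (p.2.1.1 = 1 ∧ 1 ≤ rep S p.1 0 - rep S p.1 1) ∨ (p.2.1.1 = 2 ∧ 1 ≤ rep S p.1 0 - rep S p.1 1)))
  (hneg : neg = cube \ (cut ∪ sh ∪ pos))

/-! ### The cut: the bisected `(0,1)`-plaquettes on the mirror as a Gram kernel -/

section Cut

variable {N : ℕ} (ρ : G →* Matrix (Fin N) (Fin N) ℂ)
  {cl : Plaquette 4 S → GaugeConfig 4 S G → G}
  (hcl : cl = fun p U => U (p.1, 0) * U (p.1.shift 0, 1))

include hcut hcl in
omit [NeZero S] in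
/-- **The cut identity**: for a cut plaquette `U_p = W₊ (W₊ ∘ Θ)⁻¹` with `W₊ = U(x,e₀) U(x+e₀,e₁)`, hence
`Re tr ρ(U_p) = Re ∑_{ab} ρ(W₊(U))_{ab} conj ρ(W₊(Θ U))_{ab}`. -/
theorem re_trace_eq_of_mem_cut (hu : ∀ g, ρ g ∈ Matrix.unitaryGroup (Fin N) ℂ) {p : Plaquette 4 S} (hp : p ∈ cut)
    (U : GaugeConfig 4 S G) :
    (ρ (plaquetteHolonomy U p.1 p.2.1.1 p.2.1.2)).trace.re =
      (∑ a, ∑ b, ρ (cl p U) a b * conj (ρ (cl p (configPerm (Equiv.swap (0 : Fin 4) 1) U)) a b)).re := by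
  obtain ⟨-, hq, hv⟩ := (hcut p).1 hp
  rw [← TiltedTorusRP.re_trace_map_mul_inv ρ hu, hcl, hq]
  simp only [Fin.isValue, configPerm_swap_apply, sitePerm_shift, sitePerm_swap_eq_self_of_rep hv,
    Equiv.swap_apply_left, Equiv.swap_apply_right, plaquetteHolonomy]
  congr 2
  group

include hRS hcut hcl in
omit [MeasurableSpace G] in
/-- The half-plaquette `W₊` depends only on the links of the closed positive half-cube. -/
theorem cl_congr {p : Plaquette 4 S} (hp : p ∈ cut) {U V : GaugeConfig 4 S G}
    (hUV : ∀ e ∈ {e : Edge 4 S | PosHalfEdge S R e}, U e = V e) : cl p U = cl p V := by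
  obtain ⟨h1, h2⟩ := edges_of_mem_cut hRS hcut hp
  rw [hcl]
  simp only [hUV _ h1, hUV _ h2]

variable {β : ℝ} {a : Plaquette 4 S × Fin N × Fin N × Bool → GaugeConfig 4 S G → ℂ}
  (ha : a = fun i U => if i.1 ∈ cut then (Real.sqrt (β / 2) : ℂ) *
    (if i.2.2.2 then conj (ρ (cl i.1 U) i.2.1 i.2.2.1) else ρ (cl i.1 U) i.2.1 i.2.2.1) else 0)

include hcut hcl ha in
/-- **The cut Boltzmann weight is a Gram kernel**: with `aᵢ ∈ {√(β/2) ρ(W₊)_{ab}, √(β/2) conj ρ(W₊)_{ab}}` on cut plaquettes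
(`0` else), `∑ᵢ aᵢ(U) conj aᵢ(Θ U) = β X_cut(U)`. -/
theorem sum_a_mul_conj (hu : ∀ g, ρ g ∈ Matrix.unitaryGroup (Fin N) ℂ) (hβ : 0 ≤ β) (U : GaugeConfig 4 S G) :
    ∑ i, a i U * conj (a i (configPerm (Equiv.swap (0 : Fin 4) 1) U)) =
      ((β * ∑ p ∈ cut, (ρ (plaquetteHolonomy U p.1 p.2.1.1 p.2.1.2)).trace.re : ℝ) : ℂ) := by
  have hs : (Real.sqrt (β / 2) : ℂ) * (Real.sqrt (β / 2) : ℂ) = ((β / 2 : ℝ) : ℂ) := by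
    rw [← Complex.ofReal_mul, Real.mul_self_sqrt (by linarith)]
  have hpt : ∀ p : Plaquette 4 S,
      ∑ r : Fin N × Fin N × Bool, a (p, r) U * conj (a (p, r) (configPerm (Equiv.swap (0 : Fin 4) 1) U)) =
        if p ∈ cut then ((β * (ρ (plaquetteHolonomy U p.1 p.2.1.1 p.2.1.2)).trace.re : ℝ) : ℂ) else 0 := by
    intro p
    by_cases hp : p ∈ cut
    · rw [if_pos hp, re_trace_eq_of_mem_cut hcut ρ hcl hu hp U, Complex.re_sum, Finset.mul_sum, Complex.ofReal_sum,
        Fintype.sum_prod_type]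
      refine Finset.sum_congr rfl fun x _ => ?_
      rw [Complex.re_sum, Finset.mul_sum, Complex.ofReal_sum, Fintype.sum_prod_type]
      refine Finset.sum_congr rfl fun y _ => ?_
      rw [Fintype.sum_bool]
      subst ha
      simp only [if_pos hp, ↓reduceIte, Bool.false_eq_true, map_mul, Complex.conj_ofReal, Complex.conj_conj]
      set u := ρ (cl p U) x y
      set v := ρ (cl p (configPerm (Equiv.swap (0 : Fin 4) 1) U)) x y
      calc (Real.sqrt (β / 2) : ℂ) * conj u * ((Real.sqrt (β / 2) : ℂ) * v) +
            (Real.sqrt (β / 2) : ℂ) * u * ((Real.sqrt (β / 2) : ℂ) * conj v)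
          = ((Real.sqrt (β / 2) : ℂ) * (Real.sqrt (β / 2) : ℂ)) * (u * conj v + conj (u * conj v)) := by
            simp only [map_mul, Complex.conj_conj]; ring
        _ = ((β * (u * conj v).re : ℝ) : ℂ) := by
            rw [hs, Complex.add_conj]; push_cast; ring
    · rw [if_neg hp]
      refine Finset.sum_eq_zero fun r _ => ?_
      subst ha
      simp only [if_neg hp, zero_mul]
  rw [Fintype.sum_prod_type]
  simp_rw [hpt]
  rw [Finset.sum_ite_mem, Finset.univ_inter, Finset.mul_sum, Complex.ofReal_sum]

include ha in
omit [MeasurableSpace G] [NeZero S] in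
/-- The Gram coefficients are bounded by `√(β/2)`. -/
theorem norm_a_le (hu : ∀ g, ρ g ∈ Matrix.unitaryGroup (Fin N) ℂ) (i : Plaquette 4 S × Fin N × Fin N × Bool)
    (U : GaugeConfig 4 S G) : ‖a i U‖ ≤ Real.sqrt (β / 2) := by
  subst ha
  dsimp only
  split_ifs with hk hb
  · rw [norm_mul, Complex.norm_real, Real.norm_eq_abs, abs_of_nonneg (Real.sqrt_nonneg _), Complex.norm_conj]
    exact mul_le_of_le_one_right (Real.sqrt_nonneg _) (TiltedTorusRP.norm_entry_le_one ρ hu _ _ _)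
  · rw [norm_mul, Complex.norm_real, Real.norm_eq_abs, abs_of_nonneg (Real.sqrt_nonneg _)]
    exact mul_le_of_le_one_right (Real.sqrt_nonneg _) (TiltedTorusRP.norm_entry_le_one ρ hu _ _ _)
  · rw [norm_zero]; exact Real.sqrt_nonneg _

include hRS hcut hcl ha in
omit [MeasurableSpace G] in
/-- The Gram coefficients depend only on the links of the closed positive half-cube. -/
theorem dependsOn_a (i : Plaquette 4 S × Fin N × Fin N × Bool) : DependsOn (a i) {e : Edge 4 S | PosHalfEdge S R e} := by
  intro U V hUV
  subst ha
  by_cases hk : i.1 ∈ cut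
  · simp only [if_pos hk, cl_congr hRS hcut hcl hk hUV]
  · simp only [if_neg hk]

variable [TopologicalSpace G] [BorelSpace G]

include hcl ha in
omit [NeZero S] in
/-- The Gram coefficients are measurable (continuous `ρ`). -/
theorem measurable_a (hρ : Continuous ρ) (i : Plaquette 4 S × Fin N × Fin N × Bool) : Measurable (a i) := by
  have hclm : ∀ x y, Measurable fun U : GaugeConfig 4 S G => ρ (cl i.1 U) x y := by
    subst hcl
    exact TiltedTorusRP.entryMeasurable_mul ρ (TiltedTorusRP.entryMeasurable_apply ρ hρ _)
      (TiltedTorusRP.entryMeasurable_apply ρ hρ _)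
  subst ha
  by_cases hk : i.1 ∈ cut
  · simp only [if_pos hk]
    by_cases hb : i.2.2.2 = true
    · simp only [hb, ↓reduceIte]
      exact (Complex.continuous_conj.measurable.comp (hclm _ _)).const_mul _
    · simp only [hb, Bool.false_eq_true, ↓reduceIte]
      exact (hclm _ _).const_mul _
  · simp only [if_neg hk]
    exact measurable_const

end Cut

/-! ### The observable `g = F · e^{β X_pos} · e^{β X_sh / 2}` and measure preservation -/

section Observable

variable {N : ℕ} (ρ : G →* Matrix (Fin N) (Fin N) ℂ)
  {β : ℝ} {F g : GaugeConfig 4 S G → ℂ}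
  (hg : g = fun U => F U * (Real.exp (β * ∑ p ∈ pos, (ρ (plaquetteHolonomy U p.1 p.2.1.1 p.2.1.2)).trace.re +
    β / 2 * ∑ p ∈ sh, (ρ (plaquetteHolonomy U p.1 p.2.1.1 p.2.1.2)).trace.re) : ℂ))

include hg in
omit [MeasurableSpace G] [NeZero S] in
/-- `g` is bounded. -/
theorem norm_g_le (hu : ∀ g, ρ g ∈ Matrix.unitaryGroup (Fin N) ℂ) {C : ℝ} (hFb : ∀ U, ‖F U‖ ≤ C) (U : GaugeConfig 4 S G) :
    ‖g U‖ ≤ |C| * Real.exp ((|β| + |β / 2|) * ((N : ℝ) * (pos.card + sh.card))) := by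
  subst hg
  rw [norm_mul, Complex.norm_real, Real.norm_eq_abs, abs_of_pos (Real.exp_pos _)]
  refine mul_le_mul ((hFb U).trans (le_abs_self _)) ?_ (Real.exp_pos _).le (abs_nonneg _)
  refine Real.exp_le_exp.2 ?_
  have h1 := abs_sum_re_trace_le ρ hu pos U
  have h2 := abs_sum_re_trace_le ρ hu sh U
  have hN : (0 : ℝ) ≤ N := Nat.cast_nonneg _
  have hcp : (0 : ℝ) ≤ pos.card := Nat.cast_nonneg _
  have hcs : (0 : ℝ) ≤ sh.card := Nat.cast_nonneg _
  rw [add_mul]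
  refine add_le_add ?_ ?_
  · calc β * ∑ p ∈ pos, (ρ (plaquetteHolonomy U p.1 p.2.1.1 p.2.1.2)).trace.re
        ≤ |β * ∑ p ∈ pos, (ρ (plaquetteHolonomy U p.1 p.2.1.1 p.2.1.2)).trace.re| := le_abs_self _
      _ = |β| * |∑ p ∈ pos, (ρ (plaquetteHolonomy U p.1 p.2.1.1 p.2.1.2)).trace.re| := abs_mul _ _
      _ ≤ |β| * ((N : ℝ) * (pos.card + sh.card)) :=
          mul_le_mul_of_nonneg_left (h1.trans (by nlinarith)) (abs_nonneg _)
  · calc β / 2 * ∑ p ∈ sh, (ρ (plaquetteHolonomy U p.1 p.2.1.1 p.2.1.2)).trace.re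
        ≤ |β / 2 * ∑ p ∈ sh, (ρ (plaquetteHolonomy U p.1 p.2.1.1 p.2.1.2)).trace.re| := le_abs_self _
      _ = |β / 2| * |∑ p ∈ sh, (ρ (plaquetteHolonomy U p.1 p.2.1.1 p.2.1.2)).trace.re| := abs_mul _ _
      _ ≤ |β / 2| * ((N : ℝ) * (pos.card + sh.card)) :=
          mul_le_mul_of_nonneg_left (h2.trans (by nlinarith)) (abs_nonneg _)

include hRS hM hsh hpos hg in
omit [MeasurableSpace G] in
/-- `g` depends only on the links of the closed positive half-cube. -/
theorem dependsOn_g (hFdep : DependsOn F {e : Edge 4 S | PosHalfEdge S R e}) :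
    DependsOn g {e : Edge 4 S | PosHalfEdge S R e} := by
  intro U V hUV
  have hMUV : ∀ e ∈ ((M : Finset (Edge 4 S)) : Set (Edge 4 S)), U e = V e :=
    fun e he => hUV e (posHalf_of_mem_M hM (Finset.mem_coe.1 he))
  subst hg
  simp only [hFdep hUV, dependsOn_sum_pos hRS hpos ρ hUV, dependsOn_sum_sh hRS hM hsh ρ hMUV]

variable [TopologicalSpace G] [BorelSpace G] [IsTopologicalGroup G]

include hg in
omit [NeZero S] in
/-- The observable `g` of the free cube is measurable in the configuration. -/
theorem measurable_cubeObs (hρ : Continuous ρ) (hF : Measurable F) : Measurable fun U : GaugeConfig 4 S G => g U := by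
  subst hg
  exact hF.mul (Complex.measurable_ofReal.comp
    (((measurable_sum_re_trace_hol ρ hρ _).const_mul β).add
      ((measurable_sum_re_trace_hol ρ hρ _).const_mul (β / 2))).exp)

variable [CompactSpace G]

/-- **The swap preserves the product Haar measure** (relabelling of the factors). -/
theorem measurePreserving_configPerm_swap :
    MeasurePreserving (configPerm (Equiv.swap (0 : Fin 4) 1) : GaugeConfig 4 S G → GaugeConfig 4 S G)
      (LatticeRP.piMeasure (haarProbability G)) (LatticeRP.piMeasure (haarProbability G)) :=
  measurePreserving_arrowCongr' (fun _ => haarProbability G) (fun _ => haarProbability G)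
    (edgePerm (Equiv.swap (0 : Fin 4) 1)) (MeasurableEquiv.refl G) fun _ => MeasurePreserving.id _

end Observable

end Param

end HalfRP

end Summit.QuantumFields.YangMills.Cruxes.DiagonalMirrorRPR.CubeSurgery

end
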